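import Summits.HodgeConjecture.HodgeConjecture.Theorems.LinearSystemTorelliLocalTubeSpanLatticeCoordinates
import Mathlib.LinearAlgebra.BilinearForm.Properties
import Mathlib.LinearAlgebra.FreeModule.PID

/-!
# Route LinearSystemTorelli — crux `LocalTubeSpan` (stmt-HodgeConjecture-2490): an adapted `ℤ`-basis of `ℤS` and its `B`-dual family

Helper file of line `Sketch`, cycle 10 (continuation lead c7), stub `adaptedBasis` of the proof of
Theorem U⁺, which runs an induction along a `ℤ`-basis `(u, w, n₃, …, n_r)` of the lattice `Λ = ℤS`
whose tail is `B`-orthogonal to a unimodular pair `(u, w)`, moving the `B`-dual basis vector at each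
step.  This file supplies that basis and the dual family:

* `localTubeSpan_adaptedBasis` — for `u, w ∈ Λ` with `⟨u, w⟩ = 1` (`B` alternating, integral on `S`,
  nondegenerate on `V = ℚS`, `Λ` finitely generated) there are `b yv : Fin (n + 2) → V` with
  `b 0 = u`, `b 1 = w`, all `b i ∈ Λ`, `b i ⟂ u, w` for `i ≥ 2`, every lattice vector an INTEGRAL
  combination of the `b i`, and `⟨yv i, b j⟩ = δ_{ij}`.

Construction.  The projection `π x = x - ⟨x,w⟩u + ⟨x,u⟩w` (`localTubeSpan_adaptedBasis_proj`) maps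
`Λ` into `N = Λ ∩ ⟨u,w⟩^⊥` because `B` is integral on `Λ`, so `Λ = ℤu + ℤw + N`; `N` is a finitely
generated (`ℤ` Noetherian) torsion-free `ℤ`-module, hence free with a finite basis `f`; the family
`(u, w, f)` is `ℚ`-linearly independent (`localTubeSpan_adaptedBasis_linearIndependent`: pairing
with `u`, `w` isolates the head, and `f` stays independent over the fraction field) and spans `V`,
so it is a `ℚ`-basis, and the dual family is the preimage of its coordinate functionals under
`B.toDual` (`localTubeSpan_adaptedBasis_dual`).

No named facts; no `sorry`.
-/

-- `Summit.HodgeConjecture.HodgeConjecture.Theorems` is the mandated namespace (single-conjunct summit: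
-- Sub = Summit), which `linter.dupNamespace` flags on every declaration; the lakefile turns the
-- linter off tree-wide (weak option), restated here so stand-alone elaboration is warning-free too.
set_option linter.dupNamespace false

noncomputable section

namespace Summit.HodgeConjecture.HodgeConjecture.Theorems

variable {V : Type} [AddCommGroup V] [Module ℚ V]

/-- The projection `x ↦ x - ⟨x,w⟩u + ⟨x,u⟩w` lands in the `B`-orthogonal complement of a pair
`(u, w)` with `⟨u, w⟩ = 1`, for `B` alternating. [folklore] -/
theorem localTubeSpan_adaptedBasis_proj (B : LinearMap.BilinForm ℚ V) (hB : B.IsAlt) {u w : V}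
    (huw : B u w = 1) (x : V) :
    B (x - B x w • u + B x u • w) u = 0 ∧ B (x - B x w • u + B x u • w) w = 0 := by
  have hwu : B w u = -1 := by rw [← hB.neg_eq, huw]
  refine ⟨?_, ?_⟩
  · rw [map_add, map_sub, map_smul, map_smul, LinearMap.add_apply, LinearMap.sub_apply,
      LinearMap.smul_apply, LinearMap.smul_apply, hB.self_eq_zero, hwu, smul_eq_mul, smul_eq_mul]
    ring
  · rw [map_add, map_sub, map_smul, map_smul, LinearMap.add_apply, LinearMap.sub_apply,
      LinearMap.smul_apply, LinearMap.smul_apply, huw, hB.self_eq_zero, smul_eq_mul, smul_eq_mul]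
    ring

/-- If `f` is `ℚ`-linearly independent and `B`-orthogonal to `u` and `w`, `⟨u, w⟩ = 1` and `B` is
alternating, then `(u, w, f)` is `ℚ`-linearly independent (pair a relation with `w`, then with `u`).
[folklore] -/
theorem localTubeSpan_adaptedBasis_linearIndependent (B : LinearMap.BilinForm ℚ V) (hB : B.IsAlt)
    {u w : V} (huw : B u w = 1) {m : ℕ} {f : Fin m → V} (hf : LinearIndependent ℚ f)
    (hfu : ∀ k, B (f k) u = 0) (hfw : ∀ k, B (f k) w = 0) :
    LinearIndependent ℚ (Matrix.vecCons u (Matrix.vecCons w f)) := by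
  have hwu : B w u = -1 := by rw [← hB.neg_eq, huw]
  have h1 : w ∉ Submodule.span ℚ (Set.range f) := by
    intro hmem
    have hle : Submodule.span ℚ (Set.range f) ≤ LinearMap.ker (B.flip u) :=
      Submodule.span_le.2 (by
        rintro _ ⟨k, rfl⟩
        rw [SetLike.mem_coe, LinearMap.mem_ker, LinearMap.BilinForm.flip_apply]
        exact hfu k)
    have h := hle hmem
    rw [LinearMap.mem_ker, LinearMap.BilinForm.flip_apply, hwu] at h
    norm_num at h
  have h2 : u ∉ Submodule.span ℚ (Set.range (Fin.cons w f : Fin (m + 1) → V)) := by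
    intro hmem
    have hle : Submodule.span ℚ (Set.range (Fin.cons w f : Fin (m + 1) → V)) ≤
        LinearMap.ker (B.flip w) :=
      Submodule.span_le.2 (by
        rintro _ ⟨i, rfl⟩
        rw [SetLike.mem_coe, LinearMap.mem_ker, LinearMap.BilinForm.flip_apply]
        refine Fin.cases ?_ (fun k => ?_) i
        · rw [Fin.cons_zero]
          exact hB.self_eq_zero w
        · rw [Fin.cons_succ]
          exact hfw k)
    have h := hle hmem
    rw [LinearMap.mem_ker, LinearMap.BilinForm.flip_apply, huw] at h
    norm_num at h
  exact (hf.finCons h1).finCons h2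

/-- A linearly independent spanning family of the finite-dimensional `ℚ`-space `V` has a `B`-dual
family for every nondegenerate bilinear form `B` (preimage of the coordinate functionals under
`B.toDual`). [folklore] -/
theorem localTubeSpan_adaptedBasis_dual [FiniteDimensional ℚ V] (B : LinearMap.BilinForm ℚ V)
    (hnd : B.Nondegenerate) {m : ℕ} (b : Fin m → V) (hli : LinearIndependent ℚ b)
    (hsp : ⊤ ≤ Submodule.span ℚ (Set.range b)) :
    ∃ yv : Fin m → V, ∀ i j, B (yv i) (b j) = if i = j then 1 else 0 := by
  refine ⟨fun i => (B.toDual hnd).symm ((Module.Basis.mk hli hsp).coord i), fun i j => ?_⟩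
  rw [LinearMap.BilinForm.apply_toDual_symm_apply, Module.Basis.coord_apply,
    ← Module.Basis.mk_apply hli hsp j, Module.Basis.repr_self, Finsupp.single_apply]
  exact if_congr eq_comm rfl rfl

/-- AN ADAPTED `ℤ`-BASIS AND ITS `B`-DUAL FAMILY.  Let `B` be alternating, nondegenerate on the
finite-dimensional `ℚ`-space `V = ℚS` and integral on `S`, with `Λ = ℤS` finitely generated, and let
`u, w ∈ Λ` with `⟨u, w⟩ = 1`.  Then there are families `b yv : Fin (n + 2) → V` with `b 0 = u`,
`b 1 = w`, every `b i ∈ Λ`, `b i ⟂ u, w` for `i ≥ 2`, every `x ∈ Λ` an integral combination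
`x = ∑ cᵢ bᵢ`, and `⟨yv i, b j⟩ = δ_{ij}` (so `b` is a `ℤ`-basis of `Λ = ℤu ⊕ ℤw ⊕ (Λ ∩ ⟨u,w⟩^⊥)`
and `yv` its `B`-dual `ℚ`-basis of `V`). [folklore] -/
theorem localTubeSpan_adaptedBasis [FiniteDimensional ℚ V] (B : LinearMap.BilinForm ℚ V)
    (hB : B.IsAlt) (hnd : B.Nondegenerate) (S : Set V)
    (hint : ∀ δ ∈ S, ∀ δ' ∈ S, ∃ n : ℤ, B δ δ' = n)
    (hfg : (Submodule.span ℤ S).FG) (hsp : Submodule.span ℚ S = ⊤)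
    {u w : V} (hu : u ∈ Submodule.span ℤ S) (hw : w ∈ Submodule.span ℤ S) (huw : B u w = 1) :
    ∃ (n : ℕ) (b yv : Fin (n + 2) → V), b 0 = u ∧ b 1 = w ∧ (∀ i, b i ∈ Submodule.span ℤ S) ∧
      (∀ i : Fin (n + 2), 2 ≤ (i : ℕ) → B (b i) u = 0 ∧ B (b i) w = 0) ∧
      (∀ x ∈ Submodule.span ℤ S, ∃ c : Fin (n + 2) → ℤ, x = ∑ i, ((c i : ℤ) : ℚ) • b i) ∧
      (∀ i j, B (yv i) (b j) = if i = j then 1 else 0) := by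
  classical
  set Λ := Submodule.span ℤ S
  have htf : IsAddTorsionFree V := IsAddTorsionFree.of_module_rat V
  -- the sublattice `N = Λ ∩ ⟨u, w⟩^⊥`, a finitely generated torsion-free `ℤ`-module, hence free
  let N : Submodule ℤ V := Λ ⊓ (LinearMap.ker ((B.flip u).restrictScalars ℤ) ⊓
    LinearMap.ker ((B.flip w).restrictScalars ℤ))
  have hmemN : ∀ {x : V}, x ∈ N ↔ x ∈ Λ ∧ B x u = 0 ∧ B x w = 0 := by
    intro x
    simp only [N, Submodule.mem_inf, LinearMap.mem_ker, LinearMap.restrictScalars_apply,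
      LinearMap.BilinForm.flip_apply]
  have hNΛ : N ≤ Λ := inf_le_left
  haveI : IsNoetherian ℤ Λ := isNoetherian_of_fg_of_noetherian Λ hfg
  haveI : IsNoetherian ℤ N := isNoetherian_of_le hNΛ
  haveI : Module.Free ℤ N := inferInstance
  let bN := Module.finBasis ℤ N
  set n := Module.finrank ℤ N
  -- its basis, pushed into `V`
  let f : Fin n → V := fun k => (bN k : V)
  have hfN : ∀ k, f k ∈ N := fun k => (bN k).2
  have hfΛ : ∀ k, f k ∈ Λ := fun k => hNΛ (hfN k)
  have hfu : ∀ k, B (f k) u = 0 := fun k => (hmemN.1 (hfN k)).2.1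
  have hfw : ∀ k, B (f k) w = 0 := fun k => (hmemN.1 (hfN k)).2.2
  have hfZ : LinearIndependent ℤ f :=
    bN.linearIndependent.map' N.subtype (Submodule.ker_subtype N)
  have hfQ : LinearIndependent ℚ f := (LinearIndependent.iff_fractionRing ℤ ℚ).1 hfZ
  -- integral coordinates of a vector of `N`
  have hrepN : ∀ (p : V) (hp : p ∈ N), p = ∑ j, ((bN.repr ⟨p, hp⟩ j : ℤ) : ℚ) • f j := by
    intro p hp
    have h1 := congrArg (fun t : N => (t : V)) (bN.sum_repr ⟨p, hp⟩)
    simp only [Submodule.coe_sum, Submodule.coe_smul] at h1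
    exact h1.symm.trans (Finset.sum_congr rfl fun j _ => (Int.cast_smul_eq_zsmul ℚ _ _).symm)
  -- the adapted family `(u, w, f)`
  let b : Fin (n + 2) → V := Matrix.vecCons u (Matrix.vecCons w f)
  have hb0 : b 0 = u := rfl
  have hb1 : b (Fin.succ 0) = w := rfl
  have hbs : ∀ k : Fin n, b k.succ.succ = f k := fun k => by
    simp only [b, Matrix.cons_val_succ]
  -- every lattice vector is an integral combination: `x = ⟨x,w⟩u - ⟨x,u⟩w + π x`, `π x ∈ N`
  have hcoord : ∀ x ∈ Λ, ∃ c : Fin (n + 2) → ℤ, x = ∑ i, ((c i : ℤ) : ℚ) • b i := by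
    intro x hx
    obtain ⟨m, hm⟩ := localTubeSpan_integral_span B S hint hx hw
    obtain ⟨k, hk⟩ := localTubeSpan_integral_span B S hint hx hu
    have hp := localTubeSpan_adaptedBasis_proj B hB huw x
    rw [hm, hk] at hp
    have hpΛ : x - (m : ℚ) • u + (k : ℚ) • w ∈ Λ :=
      Submodule.add_mem _ (Submodule.sub_mem _ hx (localTubeSpan_intCast_smul_mem S hu m))
        (localTubeSpan_intCast_smul_mem S hw k)
    have hpN : x - (m : ℚ) • u + (k : ℚ) • w ∈ N := hmemN.2 ⟨hpΛ, hp.1, hp.2⟩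
    refine ⟨Matrix.vecCons m (Matrix.vecCons (-k) fun j => bN.repr ⟨_, hpN⟩ j), ?_⟩
    rw [Fin.sum_univ_succ, Fin.sum_univ_succ]
    simp only [Matrix.cons_val_zero, Matrix.cons_val_succ, hb0, hb1, hbs]
    rw [← hrepN _ hpN]
    push_cast
    module
  -- `b` is a `ℚ`-basis of `V`
  have hbspan : ⊤ ≤ Submodule.span ℚ (Set.range b) := by
    rw [← hsp, Submodule.span_le]
    intro y hy
    obtain ⟨c, hc⟩ := hcoord y (Submodule.subset_span hy)
    rw [SetLike.mem_coe, hc]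
    exact Submodule.sum_mem _ fun i _ => Submodule.smul_mem _ _ (Submodule.subset_span ⟨i, rfl⟩)
  have hbli : LinearIndependent ℚ b :=
    localTubeSpan_adaptedBasis_linearIndependent B hB huw hfQ hfu hfw
  obtain ⟨yv, hyv⟩ := localTubeSpan_adaptedBasis_dual B hnd b hbli hbspan
  refine ⟨n, b, yv, rfl, rfl, ?_, ?_, hcoord, hyv⟩
  · refine Fin.forall_fin_succ.2 ⟨hu, Fin.forall_fin_succ.2 ⟨hw, fun k => ?_⟩⟩
    rw [hbs]
    exact hfΛ k
  · refine Fin.forall_fin_succ.2 ⟨fun h => absurd h (by simp), Fin.forall_fin_succ.2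
      ⟨fun h => absurd h (by simp), fun k _ => ?_⟩⟩
    rw [hbs]
    exact ⟨hfu k, hfw k⟩

end Summit.HodgeConjecture.HodgeConjecture.Theorems

end
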